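import Literature.Computability.AlgebraicComplexity.BDS24PresentableBorder
import Summits.ValiantsHypothesis.ValiantsHypothesis.Theorems.AnyonJetsJetConstantElimPaddingHomogenisation
import Summits.ValiantsHypothesis.ValiantsHypothesis.Theses.VPBoundarySquare
import HarnessLib

/-!
# VP-boundary square — rational `ε`-constants are presentable (road E1, stage 1)

Decomp lens-3 (border axis), g35, offer O-L3-11; route `route-ValiantsHypothesis-VPBoundarySquare`
(ladder `U → U_ε := ClosureDefinablePres → U_root := RootsDefinable`; middle arrow = census road
E1 `RootsPresentable`, BDS 2024 Lemma 4.4 in root form). BDS's PRESENTABLE border model (Def. 4.3;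
tree `Presents`, `presBorderComplexity`, `IsPresVPBarFamily`) allows `ε` as a circuit INPUT and
constants of `F` only — no division by `ε`-polynomials. HERE: rational `ε`-constants are cheap.

★ `presBorderComplexity_le_of_ratReading`: if `P ∈ F[x_σ, y_κ]`, read at
`y_j ↦ a_j(ε)/b(ε)` (`a_j, b ∈ F[ε]`, `b ≠ 0`), equals `f + O(ε)` in `F((ε))[x]`, then
`L_ε(f) ≤ 2 (3 L(P) + 2)² + Σ_j (L(a_j) + 1) + L(b) + 1` (any field `F`).

Mechanism (§3–§4): Bürgisser's integer skeleton of an optimal circuit of `P` (tree `skeleton`,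
`aeval_slotSubst_skeleton`) and the TREE's padding homogenisation
`AnyonJets.JetConstantElim.exists_padded_circuit` (weight `1` on the slots `κ`, `0` elsewhere),
base-changed `ℤ → F`, give `H` with `H(ρ) = ρ(w)^D · P(x, ρ(y) ω)` whenever `ρ(w) ω = 1`
(`aeval_of_padded`). Normalise `b(ε) = β ε^R υ`, `β ∈ F^×`, `υ = 1 + O(ε)` (§2); then
`w ↦ β⁻¹ b(ε)`, `y_j ↦ β⁻¹ a_j(ε)` gives `G ∈ F[x, ε]` with
`ε^{-RD} G = υ^D (f + O(ε)) = f + O(ε)`.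

Corollaries (§5): `presBorderComplexity_le_of_epsInv` — `ε⁻¹` as an input is free
(`P(x, ε, ε⁻¹) = f + O(ε) ⟹ L_ε(f) ≤ 2 (3 L(P) + 2)² + 4`: Bürgisser 2004's remark "build up
the needed elements of `K` from `ε, ε⁻¹` and elements of `k`" made quantitative in BDS's model);
`isPresVPBarFamily_of_ratReadings` (families); `isVNPFamily_of_ratReadings_of_closureDefinablePres`
(the edge out of `U_ε` that road E1 walks through). Stage 2 (`RootsPresentable`) is NOT here.

HONEST GRADE: folklore-grade (Strassen homogenisation + lowest-order normalisation), kernel-new,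
reusing a sibling lineage's padding kernel; unconditional size rung = stage 1 of E1; 0 new
definitions; `Q`/`P`/`M`/`U`/`U_ε` unchanged; `VP ≠ VNP` untouched.

References: Bhargav–Dwivedi–Saxena, STOC 2024, Def. 4.3, Lemma 4.4, §1.2; Bürgisser, FoCM 4
(2004), remark after Def. 2.1 (arXiv:1812.06828); Dutta–Lysikov (arXiv:2510.13049) §3.4;
Strassen, *Vermeidung von Divisionen*, Crelle 264 (1973); Bürgisser, TCS 235 (2000) §5.
-/

noncomputable section

set_option linter.dupNamespace false

open MvPolynomial Finset
open Literature.Computability.AlgebraicComplexity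
open Literature.Computability.AlgebraicComplexity.ArithCircuit
open Summit.ValiantsHypothesis.ValiantsHypothesis.Theorems.AnyonJets.JetConstantElim
  (exists_padded_circuit)

namespace Summit.ValiantsHypothesis.ValiantsHypothesis.Theorems.VPBoundarySquarePresentableConstants

universe u v

variable {F : Type u} [Field F]

/-! ### §1 Reading `F[ε] → F((ε))` = `aeval (fun _ : Unit => HahnSeries.single 1 1)` (no defs) -/

/-- The reading factors through `F[X] ↪ F⟦X⟧ ↪ F((X))`. [folklore] -/
theorem aeval_eps_eq_ofPowerSeries (p : MvPolynomial Unit F) :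
    aeval (fun _ : Unit => HahnSeries.single (1 : ℤ) (1 : F)) p =
      HahnSeries.ofPowerSeries ℤ F ((MvPolynomial.uniqueAlgEquiv F Unit p : Polynomial F) :
        PowerSeries F) := by
  induction p using MvPolynomial.induction_on with
  | C r =>
    rw [aeval_C, algebraMap_laurentSeries_apply]
    simp [Polynomial.coe_C, HahnSeries.ofPowerSeries_C]
  | add p q hp hq => simp only [map_add, hp, hq, Polynomial.coe_add]
  | mul_X p i hp =>
    simp only [map_mul, hp, aeval_X, Polynomial.coe_mul, MvPolynomial.uniqueAlgEquiv_apply,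
      eval₂_X, Polynomial.coe_X, HahnSeries.ofPowerSeries_X]

/-- The reading is injective: `p(ε) = 0 ⟹ p = 0`. [folklore] -/
theorem aeval_eps_injective :
    Function.Injective (aeval (fun _ : Unit => HahnSeries.single (1 : ℤ) (1 : F)) :
      MvPolynomial Unit F → LaurentSeries F) := by
  intro p q h
  rw [aeval_eps_eq_ofPowerSeries, aeval_eps_eq_ofPowerSeries] at h
  exact (MvPolynomial.uniqueAlgEquiv F Unit).injective
    (Polynomial.coe_injective F (HahnSeries.ofPowerSeries_injective h))

/-- `p(ε) = O(ε^0)`. [folklore] -/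
theorem isOrdGE_zero_aeval_eps (p : MvPolynomial Unit F) :
    IsOrdGE 0 (aeval (fun _ : Unit => HahnSeries.single (1 : ℤ) (1 : F)) p) := by
  rw [aeval_eps_eq_ofPowerSeries]
  exact IsOrdGE.ofPowerSeries _

/-- Reading inside `F((ε))[x]`: `aeval (· ↦ C ε) p = C (p(ε))`. [folklore] -/
theorem aeval_C_eps {τ : Type*} (p : MvPolynomial Unit F) :
    aeval (fun _ : Unit => (C (HahnSeries.single (1 : ℤ) (1 : F)) :
      MvPolynomial τ (LaurentSeries F))) p =
      C (aeval (fun _ : Unit => HahnSeries.single (1 : ℤ) (1 : F)) p) := by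
  induction p using MvPolynomial.induction_on with
  | C r => rw [aeval_C, aeval_C, MvPolynomial.algebraMap_apply]
  | add p q hp hq => rw [map_add, map_add, hp, hq, map_add]
  | mul_X p i hp => rw [map_mul, map_mul, hp, aeval_X, aeval_X, map_mul]

/-! ### §2 Normalising the denominator: `b(ε) = β ε^R · (1 + O(ε))` -/

/-- For `x ≠ 0` with `x = O(1)`: with `R = ord x ≥ 0` and `β = x_R ≠ 0`,
`υ := ε^{-R} β^{-1} x` satisfies `υ = O(1)` and `υ - 1 = O(ε)`. [folklore] -/
theorem exists_normalisation {x : LaurentSeries F} (hx : x ≠ 0) (h0 : IsOrdGE 0 x) :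
    ∃ (R : ℕ) (β : F), β ≠ 0 ∧
      IsOrdGE 0 (HahnSeries.single (-(R : ℤ)) (1 : F) * (HahnSeries.C β⁻¹ * x)) ∧
      IsOrdGE 1 (HahnSeries.single (-(R : ℤ)) (1 : F) * (HahnSeries.C β⁻¹ * x) - 1) := by
  have hβ0 : x.coeff x.order ≠ 0 := fun h => hx (HahnSeries.coeff_order_eq_zero.1 h)
  have hR0 : 0 ≤ x.order := le_of_not_gt fun h => hβ0 (h0 _ h)
  obtain ⟨R, hR⟩ := Int.eq_ofNat_of_zero_le hR0
  refine ⟨R, x.coeff x.order, hβ0, ?_, ?_⟩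
  · intro i hi
    rw [show i = (i + R) + -(R : ℤ) by ring, HahnSeries.coeff_single_mul_add, one_mul,
      HahnSeries.C_mul_eq_smul, HahnSeries.coeff_smul, smul_eq_mul]
    rw [HahnSeries.coeff_eq_zero_of_lt_order (i := i + R) (by rw [hR]; omega), mul_zero]
  · intro i hi
    have hcase : i < 0 ∨ i = 0 := by omega
    rw [HahnSeries.coeff_sub, show i = (i + R) + -(R : ℤ) by ring,
      HahnSeries.coeff_single_mul_add, one_mul, HahnSeries.C_mul_eq_smul, HahnSeries.coeff_smul,
      smul_eq_mul, HahnSeries.coeff_one]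
    rcases hcase with hi0 | rfl
    · rw [HahnSeries.coeff_eq_zero_of_lt_order (i := i + R) (by rw [hR]; omega), mul_zero,
        if_neg (by omega), sub_zero]
    · rw [zero_add, ← hR, inv_mul_cancel₀ hβ0, if_pos (by omega), sub_self]

/-- `υ = 1 + O(ε)` ⟹ `υ^D = O(1)` and `υ^D - 1 = O(ε)`. [folklore] -/
theorem isOrdGE_pow_of_one_add {υ : LaurentSeries F} (h0 : IsOrdGE 0 υ) (h1 : IsOrdGE 1 (υ - 1))
    (D : ℕ) : IsOrdGE 0 (υ ^ D) ∧ IsOrdGE 1 (υ ^ D - 1) := by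
  induction D with
  | zero => exact ⟨by rw [pow_zero]; exact IsOrdGE.one, by rw [pow_zero, sub_self]; exact .zero 1⟩
  | succ D ih =>
    refine ⟨by rw [pow_succ]; simpa using ih.1.mul h0, ?_⟩
    rw [show υ ^ (D + 1) - 1 = υ ^ D * (υ - 1) + (υ ^ D - 1) by ring]
    exact (by simpa using ih.1.mul h1 : IsOrdGE 1 (υ ^ D * (υ - 1))).add ih.2

/-! ### §3 Homogenising the slots of a circuit (skeleton + padding, from the tree) -/

/-- De-homogenisation: if `x_i ↦ x_i w^{w_i}` turns `H` into `w^D · Q(x)`, then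
`H(ρ) = ρ(w)^D · Q(ρ_i ω^{w_i})` at any point with `ρ(w) ω = 1`. [folklore] -/
theorem aeval_of_padded {ι : Type*} {A : Type*} [CommRing A] [Algebra F A] (wt : ι → ℕ)
    {D : ℕ} {H : MvPolynomial (Option ι) F} {Q : MvPolynomial ι F}
    (hH : bind₁ (fun o : Option ι => o.elim (X none) fun i => X (some i) * X none ^ wt i) H =
      X none ^ D * rename some Q)
    (ρ : Option ι → A) (ω : A) (hω : ρ none * ω = 1) :
    aeval ρ H = ρ none ^ D * aeval (fun i => ρ (some i) * ω ^ wt i) Q := by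
  set ρ' : Option ι → A := fun o => o.elim (ρ none) fun i => ρ (some i) * ω ^ wt i with hρ'
  have key : (fun o : Option ι => aeval ρ' (Option.elim o (X none : MvPolynomial (Option ι) F)
      fun i => X (some i) * X none ^ wt i)) = ρ := by
    funext o
    rcases o with _ | i
    · simp [hρ']
    · simp only [Option.elim, map_mul, map_pow, aeval_X, hρ']
      rw [mul_assoc, ← mul_pow, mul_comm ω, hω, one_pow, mul_one]
  have h1 := congrArg (aeval ρ') hH
  rwa [aeval_bind₁, key, map_mul, map_pow, aeval_X, aeval_rename] at h1

/-- **Homogenising the `κ`-slots of a circuit costs `O(s²)`** (tree: integer skeleton +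
padding homogenisation): for `P ∈ F[x_σ, y_κ]` there are slot constants `γ` (`m = 4 L(P) + 1`),
the base-changed skeleton `S` with `S(x, y, γ) = P`, and `H ∈ F[(x, y, c), w]` of complexity
`≤ 2 (3 L(P) + 2)²` with `H(x, y w, c, w) = w^{2^{3 L(P)}} · S(x, y, c)`.
[folklore; Strassen 1973; tree `exists_padded_circuit`, `aeval_slotSubst_skeleton`] -/
theorem exists_slotHomogenisation {σ κ : Type*} (P : MvPolynomial (σ ⊕ κ) F) :
    ∃ (m : ℕ) (γ : Fin m → F) (S : MvPolynomial ((σ ⊕ κ) ⊕ Fin m) F)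
      (H : MvPolynomial (Option ((σ ⊕ κ) ⊕ Fin m)) F),
      complexity H ≤ 2 * (3 * complexity P + 2) ^ 2 ∧
      aeval (Sum.elim X fun v => C (γ v)) S = P ∧
      bind₁ (fun o : Option ((σ ⊕ κ) ⊕ Fin m) => o.elim (X none) fun i =>
          X (some i) * X none ^ Sum.elim (Sum.elim (fun _ : σ => (0 : ℕ)) fun _ : κ => 1)
            (fun _ : Fin m => 0) i) H =
        X none ^ 2 ^ (3 * complexity P) * rename some S := by
  classical
  obtain ⟨Γ, hΓ2, hΓc, hΓs⟩ := exists_computes_size_eq_complexity P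
  set w : (σ ⊕ κ) ⊕ Fin (4 * Γ.size + 1) → ℕ :=
    Sum.elim (Sum.elim (fun _ : σ => 0) fun _ : κ => 1) fun _ => 0 with hw
  have hw1 : ∀ i, w i ≤ 1 := by rintro ((i | i) | i) <;> simp [hw]
  obtain ⟨Γ', h2', -, hsize, hκ⟩ := exists_padded_circuit w hw1 (skeleton Γ)
    (isFanInTwo_skeleton Γ) (hasSignConstants_skeleton Γ)
  rw [size_skeleton] at hsize hκ
  refine ⟨4 * Γ.size + 1, fun v => slotConst Γ v,
    MvPolynomial.map (Int.castRingHom F) (skeleton Γ).eval,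
    MvPolynomial.map (Int.castRingHom F) Γ'.eval, ?_, ?_, ?_⟩
  · calc complexity (MvPolynomial.map (Int.castRingHom F) Γ'.eval)
        ≤ complexity Γ'.eval := ArithCircuit.complexity_map_le _ _
      _ ≤ Γ'.size := complexity_le_size h2' rfl
      _ ≤ 2 * (3 * Γ.size + 2) ^ 2 := hsize
      _ = 2 * (3 * complexity P + 2) ^ 2 := by rw [hΓs]
  · -- the skeleton evaluates back to `P` (over `ℤ`), read over `F`
    have h := aeval_slotSubst_skeleton Γ hΓ2
    rw [hΓc] at h
    rw [← h, slotSubst, ← algebraMap_int_eq, aeval_map_algebraMap]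
  · -- the padding identity, base-changed `ℤ → F`
    rw [MvPolynomial.aeval_def, RingHom.ext_int (algebraMap ℤ _)
      (C : ℤ →+* MvPolynomial (Option ((σ ⊕ κ) ⊕ Fin (4 * Γ.size + 1))) ℤ)] at hκ
    have hφ := congrArg (MvPolynomial.map (Int.castRingHom F)) hκ
    rw [map_eval₂, map_mul, map_pow, map_X, map_rename] at hφ
    rw [← hΓs, ← aeval_eq_bind₁, MvPolynomial.aeval_def, MvPolynomial.algebraMap_eq]
    have hg : (fun o : Option ((σ ⊕ κ) ⊕ Fin (4 * Γ.size + 1)) =>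
        o.elim (X none : MvPolynomial _ F) fun i => X (some i) * X none ^
          Sum.elim (Sum.elim (fun _ : σ => (0 : ℕ)) fun _ : κ => 1) (fun _ : Fin _ => 0) i) =
        MvPolynomial.map (Int.castRingHom F) ∘ fun o =>
          o.elim (X none) fun i => X (some i) * X none ^ w i := by
      funext o
      rcases o with _ | i
      · simp
      · simp [hw]
    rw [hg]; exact hφ

/-! ### §4 ★ Rational `ε`-constants are presentable -/

/-- ★ **Rational `ε`-constants are presentable.** If `P(x, a(ε)/b(ε)) = f + O(ε)` in
`F((ε))[x]` (`a_j, b ∈ F[ε]`, `b ≠ 0`), then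
`L_ε(f) ≤ 2 (3 L(P) + 2)² + Σ_j (L(a_j) + 1) + L(b) + 1`. [folklore; BhargavDwivediSaxena2024
Def. 4.3 + Strassen1973; Burgisser2004Factors, remark after Def. 2.1] -/
theorem presBorderComplexity_le_of_ratReading {σ κ : Type*} [Fintype σ] [Fintype κ]
    (P : MvPolynomial (σ ⊕ κ) F) (a : κ → MvPolynomial Unit F) {b : MvPolynomial Unit F}
    (hb : b ≠ 0) (f : MvPolynomial σ F)
    (hP : PolyOrdGE 1 (aeval (Sum.elim X fun j =>
        C ((aeval (fun _ : Unit => HahnSeries.single (1 : ℤ) (1 : F)) (a j)) /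
          (aeval (fun _ : Unit => HahnSeries.single (1 : ℤ) (1 : F)) b))) P -
      MvPolynomial.map (algebraMap F (LaurentSeries F)) f)) :
    presBorderComplexity f ≤
      2 * (3 * complexity P + 2) ^ 2 + (∑ j, (complexity (a j) + 1)) + (complexity b + 1) := by
  classical
  set ε : LaurentSeries F := HahnSeries.single (1 : ℤ) (1 : F)
  set rd : MvPolynomial Unit F →ₐ[F] LaurentSeries F := aeval fun _ : Unit => ε
  have hbh : rd b ≠ 0 := fun h => hb (aeval_eps_injective (by rw [map_zero]; exact h))
  -- normalise the denominator
  obtain ⟨R, β, hβ, hυ0, hυ1⟩ := exists_normalisation hbh (isOrdGE_zero_aeval_eps b)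
  set b₁ : LaurentSeries F := HahnSeries.C β⁻¹ * rd b with hb₁
  set υ : LaurentSeries F := HahnSeries.single (-(R : ℤ)) (1 : F) * b₁ with hυ
  have hCβ : (HahnSeries.C β⁻¹ : LaurentSeries F) ≠ 0 :=
    HahnSeries.C_ne_zero (inv_ne_zero hβ)
  have hb₁0 : b₁ ≠ 0 := mul_ne_zero hCβ hbh
  -- homogenise the slots
  obtain ⟨m, γ, S, H, hHc, hS, hH⟩ := exists_slotHomogenisation P
  set D : ℕ := 2 ^ (3 * complexity P)
  -- the presenting polynomial `G(x, ε)`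
  set θ : Option ((σ ⊕ κ) ⊕ Fin m) → MvPolynomial (Option σ) F := fun o => o.elim
      (C β⁻¹ * rename (fun _ : Unit => (none : Option σ)) b)
      (Sum.elim (Sum.elim (fun x : σ => X (some x))
        fun j : κ => C β⁻¹ * rename (fun _ : Unit => (none : Option σ)) (a j))
        fun v : Fin m => C (γ v)) with hθ
  rw [presBorderComplexity_le_iff]
  refine ⟨R * D, aeval θ H, ?_, ?_⟩
  · -- SIZE
    have hpoly : ∀ p : MvPolynomial Unit F,
        complexity (C β⁻¹ * rename (fun _ : Unit => (none : Option σ)) p) ≤ complexity p + 1 := by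
      intro p
      have h1 := complexity_mul_le_holds (C β⁻¹ : MvPolynomial (Option σ) F)
        (rename (fun _ : Unit => (none : Option σ)) p)
      have h2 := complexity_rename_le_holds' (fun _ : Unit => (none : Option σ)) p
      have h3 : complexity (C β⁻¹ : MvPolynomial (Option σ) F) = 0 := complexity_C_holds _
      omega
    have hsum : ∑ o, complexity (θ o) ≤ (complexity b + 1) + ∑ j, (complexity (a j) + 1) := by
      rw [Fintype.sum_option, Fintype.sum_sum_type, Fintype.sum_sum_type]
      have hx : ∀ x : σ, complexity (θ (some (Sum.inl (Sum.inl x)))) = 0 :=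
        fun x => complexity_X_holds _
      have hv : ∀ v : Fin m, complexity (θ (some (Sum.inr v))) = 0 := fun v => complexity_C_holds _
      simp only [hx, hv, Finset.sum_const_zero, zero_add, add_zero]
      exact add_le_add (hpoly b) (Finset.sum_le_sum fun j _ => hpoly (a j))
    have := complexity_aeval_le H θ
    omega
  · -- PRESENTATION
    unfold Presents
    rw [aeval_map_algebraMap, MvPolynomial.comp_aeval_apply]
    -- the point `ρ = epsSubst ∘ θ` of `F((ε))[x]` and its `w`-inverse `ω`
    set ρ : Option ((σ ⊕ κ) ⊕ Fin m) → MvPolynomial σ (LaurentSeries F) :=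
      fun o => aeval (epsSubst F σ) (θ o) with hρ
    have hCrd : ∀ p : MvPolynomial Unit F,
        aeval (epsSubst F σ) (C β⁻¹ * rename (fun _ : Unit => (none : Option σ)) p) =
          C (HahnSeries.C β⁻¹ * rd p) := fun p => by
      rw [map_mul (aeval (epsSubst F σ)), aeval_C, MvPolynomial.algebraMap_apply,
        algebraMap_laurentSeries_apply, aeval_rename, map_mul C]
      congr 1
      exact aeval_C_eps p
    have hρnone : ρ none = C b₁ := hCrd b
    have hω : ρ none * C b₁⁻¹ = 1 := by rw [hρnone, ← map_mul, mul_inv_cancel₀ hb₁0, map_one]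
    have hmain := aeval_of_padded _ hH ρ (C b₁⁻¹) hω
    -- the de-homogenised point is the rational reading
    have hread : aeval (fun i => ρ (some i) * C b₁⁻¹ ^ Sum.elim (Sum.elim
        (fun _ : σ => (0 : ℕ)) fun _ : κ => 1) (fun _ : Fin m => 0) i) S =
        aeval (Sum.elim X fun j => C (rd (a j) / rd b)) P := by
      have hfun : (fun i => ρ (some i) * C b₁⁻¹ ^ Sum.elim (Sum.elim (fun _ : σ => (0 : ℕ))
          fun _ : κ => 1) (fun _ : Fin m => 0) i) = fun i =>
          aeval (Sum.elim X fun j => C (rd (a j) / rd b)) (Sum.elim X (fun v => C (γ v)) i) := by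
        funext i
        rcases i with (x | j) | v
        · simp only [hρ, hθ, epsSubst, Option.elim_some, Sum.elim_inl, aeval_X, pow_zero,
            mul_one]
        · simp only [hρ, hθ, Option.elim_some, Sum.elim_inl, Sum.elim_inr, aeval_X, pow_one]
          have hq : HahnSeries.C β⁻¹ * rd (a j) * b₁⁻¹ = rd (a j) / rd b := by
            rw [hb₁, mul_inv, div_eq_mul_inv, show HahnSeries.C β⁻¹ * rd (a j) *
              ((HahnSeries.C β⁻¹)⁻¹ * (rd b)⁻¹) = HahnSeries.C β⁻¹ * (HahnSeries.C β⁻¹)⁻¹ *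
              (rd (a j) * (rd b)⁻¹) by ring, mul_inv_cancel₀ hCβ, one_mul]
          rw [hCrd, ← map_mul C, hq]
        · simp only [hρ, hθ, Option.elim_some, Sum.elim_inr, aeval_C, pow_zero, mul_one]
      have hcomp := MvPolynomial.comp_aeval_apply (Sum.elim X fun v => C (γ v))
        (aeval (Sum.elim X fun j => C (rd (a j) / rd b))) S
      rw [hS] at hcomp; rw [hfun, ← hcomp]
    -- `ε^{-RD} b₁^D = υ^D`
    have hexp : D • (-(R : ℤ)) = -((R * D : ℕ) : ℤ) := by
      simp only [nsmul_eq_mul]; push_cast; ring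
    have hυD : (C (HahnSeries.single (-((R * D : ℕ) : ℤ)) (1 : F)) :
        MvPolynomial σ (LaurentSeries F)) * C b₁ ^ D = C (υ ^ D) := by
      rw [hυ, mul_pow, HahnSeries.single_pow, one_pow, hexp, ← map_pow C, ← map_mul C]
    rw [hmain, hread, hρnone, ← mul_assoc, hυD]
    -- split off the `O(ε)` error of the reading
    obtain ⟨hD0, hD1⟩ := isOrdGE_pow_of_one_add hυ0 hυ1 D
    set E := aeval (Sum.elim X fun j => C (rd (a j) / rd b)) P -
      MvPolynomial.map (algebraMap F (LaurentSeries F)) f with hE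
    have hsplit : C (υ ^ D) * aeval (Sum.elim X fun j => C (rd (a j) / rd b)) P -
        MvPolynomial.map (algebraMap F (LaurentSeries F)) f =
        C (υ ^ D - 1) * MvPolynomial.map (algebraMap F (LaurentSeries F)) f + C (υ ^ D) * E := by
      rw [hE, map_sub C, map_one C]; ring
    rw [hsplit]
    have h1 : PolyOrdGE (1 + 0)
        (C (υ ^ D - 1) * MvPolynomial.map (algebraMap F (LaurentSeries F)) f) :=
      (PolyOrdGE.C hD1).mul (PolyOrdGE.map_algebraMap f)
    have h2 : PolyOrdGE (0 + 1) (C (υ ^ D) * E) := (PolyOrdGE.C hD0).mul hP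
    exact (by simpa using h1 : PolyOrdGE 1 _).add (by simpa using h2 : PolyOrdGE 1 _)

/-! ### §5 Corollaries -/

/-- **`ε⁻¹` as an input is free** (Bürgisser 2004's remark "we may as well require to build up
the needed elements of `K` from `ε, ε⁻¹` and elements of `k`", made quantitative inside BDS's
division-free presentable model): if `P(x, ε, ε⁻¹) = f + O(ε)` for `P ∈ F[x_σ, y_Bool]`
(`false ↦ ε = ε²/ε`, `true ↦ ε⁻¹ = 1/ε`), then `L_ε(f) ≤ 2 (3 L(P) + 2)² + 4`.
[cite: Burgisser2004Factors, remark after Def. 2.1; BhargavDwivediSaxena2024, Def. 4.3] -/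
theorem presBorderComplexity_le_of_epsInv {σ : Type*} [Fintype σ]
    (P : MvPolynomial (σ ⊕ Bool) F) (f : MvPolynomial σ F)
    (hP : PolyOrdGE 1 (aeval (Sum.elim X fun s : Bool => C (if s
        then (HahnSeries.single (1 : ℤ) (1 : F))⁻¹ else HahnSeries.single (1 : ℤ) (1 : F))) P -
      MvPolynomial.map (algebraMap F (LaurentSeries F)) f)) :
    presBorderComplexity f ≤ 2 * (3 * complexity P + 2) ^ 2 + 4 := by
  classical
  have hread : (Sum.elim X fun s : Bool => C (if s then (HahnSeries.single (1 : ℤ) (1 : F))⁻¹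
      else HahnSeries.single (1 : ℤ) (1 : F)) : σ ⊕ Bool → MvPolynomial σ (LaurentSeries F)) =
      Sum.elim X fun j => C ((aeval (fun _ : Unit => HahnSeries.single (1 : ℤ) (1 : F))
          (cond j (1 : MvPolynomial Unit F) (X () ^ 2))) /
        (aeval (fun _ : Unit => HahnSeries.single (1 : ℤ) (1 : F))
          (X () : MvPolynomial Unit F))) := by
    funext i
    rcases i with x | (_ | _)
    · rfl
    · simp [sq]
    · simp
  rw [hread] at hP
  have h := presBorderComplexity_le_of_ratReading P
    (fun s : Bool => cond s (1 : MvPolynomial Unit F) (X () ^ 2)) (MvPolynomial.X_ne_zero ()) f hP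
  have h1 : complexity (1 : MvPolynomial Unit F) = 0 := by rw [← C_1]; exact complexity_C_holds _
  have h3 : complexity (X () : MvPolynomial Unit F) = 0 := complexity_X_holds _
  have h2 : complexity (X () ^ 2 : MvPolynomial Unit F) ≤ 1 := by
    rw [sq]; have := complexity_mul_le_holds (X () : MvPolynomial Unit F) (X ()); omega
  simp only [Fintype.sum_bool, cond_true, cond_false, h1, h3] at h
  omega

/-- **Family version**: p-families presented with rational `ε`-constants (`P_n`, the number of
slots `u n`, `Σ_j L(a_{n,j})`, `L(b_n)` p-bounded) are in `\overline{VP}_ε` (`IsPresVPBarFamily`).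
[cite: BhargavDwivediSaxena2024, Def. 4.3] -/
theorem isPresVPBarFamily_of_ratReadings {ς : ℕ → Type v} [∀ n, Fintype (ς n)]
    (f : ∀ n, MvPolynomial (ς n) F) (u : ℕ → ℕ) (P : ∀ n, MvPolynomial (ς n ⊕ Fin (u n)) F)
    (a : ∀ n, Fin (u n) → MvPolynomial Unit F) (b : ℕ → MvPolynomial Unit F) (hb : ∀ n, b n ≠ 0)
    (hP : ∀ n, PolyOrdGE 1 (aeval (Sum.elim X fun j =>
        C ((aeval (fun _ : Unit => HahnSeries.single (1 : ℤ) (1 : F)) (a n j)) /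
          (aeval (fun _ : Unit => HahnSeries.single (1 : ℤ) (1 : F)) (b n)))) (P n) -
      MvPolynomial.map (algebraMap F (LaurentSeries F)) (f n)))
    (hs : IsPBounded fun n => complexity (P n))
    (hc : IsPBounded fun n => (∑ j, complexity (a n j)) + complexity (b n) + u n) :
    IsPresVPBarFamily f := by
  classical
  have hB : IsPBounded fun n => 2 * (3 * complexity (P n) + 2) ^ 2 +
      (((∑ j, complexity (a n j)) + complexity (b n) + u n) + 1) :=
    IsPBounded.add_holds (IsPBounded.mul_holds (IsPBounded.const 2) (IsPBounded.pow_holds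
      (IsPBounded.add_holds (IsPBounded.mul_holds (IsPBounded.const 3) hs) (IsPBounded.const 2)) 2))
      (IsPBounded.add_holds hc (IsPBounded.const 1))
  refine hB.mono fun n => ?_
  have h := presBorderComplexity_le_of_ratReading (P n) (a n) (hb n) (f n) (hP n)
  have hsum : ∑ j, (complexity (a n j) + 1) = (∑ j, complexity (a n j)) + u n := by
    rw [sum_add_distrib, sum_const, card_univ, Fintype.card_fin, smul_eq_mul, mul_one]
  rw [hsum] at h
  omega

/-- **The edge out of `U_ε` that road E1 walks through**: under `ClosureDefinablePres` (item
23449: `\overline{VP}_ε ⊆ VNP` over `ℂ` on p-families) every p-family presented with rational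
`ε`-constants of p-bounded size is in `VNP`. [cite: BhargavDwivediSaxena2024, Def. 4.3, §1.2] -/
theorem isVNPFamily_of_ratReadings_of_closureDefinablePres
    (hU : Theses.VPBoundarySquare.ClosureDefinablePres) (v : ℕ → ℕ)
    (f : ∀ n, MvPolynomial (Fin (v n)) ℂ) (hf : IsPFamily f) (u : ℕ → ℕ)
    (P : ∀ n, MvPolynomial (Fin (v n) ⊕ Fin (u n)) ℂ)
    (a : ∀ n, Fin (u n) → MvPolynomial Unit ℂ) (b : ℕ → MvPolynomial Unit ℂ) (hb : ∀ n, b n ≠ 0)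
    (hP : ∀ n, PolyOrdGE 1 (aeval (Sum.elim X fun j =>
        C ((aeval (fun _ : Unit => HahnSeries.single (1 : ℤ) (1 : ℂ)) (a n j)) /
          (aeval (fun _ : Unit => HahnSeries.single (1 : ℤ) (1 : ℂ)) (b n)))) (P n) -
      MvPolynomial.map (algebraMap ℂ (LaurentSeries ℂ)) (f n)))
    (hs : IsPBounded fun n => complexity (P n))
    (hc : IsPBounded fun n => (∑ j, complexity (a n j)) + complexity (b n) + u n) :
    IsVNPFamily f :=
  hU v f hf (isPresVPBarFamily_of_ratReadings f u P a b hb hP hs hc)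

end Summit.ValiantsHypothesis.ValiantsHypothesis.Theorems.VPBoundarySquarePresentableConstants
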